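import Literature.NumberTheory.LFunctions.ExplicitSecondDerivTest
import Literature.NumberTheory.LFunctions.ExplicitAProcess
import Literature.NumberTheory.LFunctions.DhirInequalities
import HarnessLib

/-!
# Yang's explicit third-derivative test (Yang 2024, Lemma 2.4): the `AB(0,1)` process

Topic `Literature/NumberTheory/LFunctions`. A. Yang, *Explicit bounds on `ζ(s)` in the critical
strip and a zero-free region*, J. Math. Anal. Appl. 534 (2024) = arXiv:2301.03165, Lemma 2.4
(explicit third derivative test): "Let `f(x)` have three continuous derivatives and suppose `f'''`
is monotonic and satisfies `λ₃ ≤ |f'''(x)| ≤ hλ₃` for all `x ∈ (a, a + N]`, where `λ₃ > 0`, `h > 1`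
and `a, N` are integers. Then, for any `η₃ > 0`, we have
`S_f(a, N) ≤ A₃(η₃, h) h^{1/2} N λ₃^{1/6} + B₃(η₃) N^{1/2} λ₃^{-1/6}` where
`A₃ := √(1/(η₃h) + (32/(15√π)) √(η₃ + λ₀^{1/3}) + (1/3)(η₃ + λ₀^{1/3}) λ₀^{1/3}) · δ₃`,
`B₃ := (√32/(√3 π^{1/4} η₃^{1/4})) δ₃`,
`λ₀ := (1/η₃ + 32 η₃^{1/2} h/(15√π))^{-3}`, `δ₃ := √(1/2 + (1/2)√(1 + (3/8) π^{1/2} η₃^{3/2}))`."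
These are the base constants `A₃, B₃` of the explicit `k`-th derivative tests (Yang, Lemma 2.5;
Patel–Yang 2024, Lemma 1.4) that enter the explicit sub-Weyl bound for `ζ(1/2 + it)`.

Everything here is PROVED, following the printed proof: the trivial bound in the two extreme
ranges `λ₃ ≥ λ₀` and `λ₃ ≤ λ₁ := (η₃/(κN))³` (`κ = δ₃² - 1`), and otherwise the explicit `A`-process
(`Literature.NumberTheory.LFunctions.VdC.aProcess_yang`) with `q = ⌈η₃ λ₃^{-1/3}⌉`, the explicit
second-derivative test (`Literature.NumberTheory.LFunctions.VdC.secondDerivTest_yang`) for the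
differenced phases `g_r = f(· + r) - f` (`g_r'' = r f'''(ξ)`), and the weighted power sums
`∑ (1 - r/q) r^s` (`Literature.NumberTheory.LFunctions.VdC.dhir_half`, `dhir_one`, `dhir_neg_half`).
The monotonicity of `f'''` is not used (it is not used in the printed proof either); `h ≥ 1`
suffices; the hypothesis `λ₃ ≤ |f'''| ≤ hλ₃` is taken in the form "`λ₃ ≤ f''' ≤ hλ₃` on `[a, b]`, or
`λ₃ ≤ -f''' ≤ hλ₃` on `[a, b]`".

## Definitions (the printed constants)

* `Literature.NumberTheory.LFunctions.VdC.yangK η h = 1/η + 32 η^{1/2} h/(15 √π)` (so that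
  `λ₀ = yangK^{-3}`, `λ₀^{1/3} = yangK⁻¹`), `Literature.NumberTheory.LFunctions.VdC.yangLambda0`,
  `Literature.NumberTheory.LFunctions.VdC.yangKappa` (`κ = (1/2)√(1 + (3/8)√π η^{3/2}) - 1/2`),
  `Literature.NumberTheory.LFunctions.VdC.yangDelta3`, `Literature.NumberTheory.LFunctions.VdC.yangA3`,
  `Literature.NumberTheory.LFunctions.VdC.yangB3`.

## Main results

* `Literature.NumberTheory.LFunctions.VdC.yangDelta3_sq` (`δ₃² = 1 + κ`), `…yangKappa_mul`
  (`κ(1 + κ) = (3/32)√π η^{3/2}`), `…yangB3_sq_eq` (`B₃² = η/κ`), `…yangA3_div_ge`.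
* `Literature.NumberTheory.LFunctions.VdC.norm_diffSum_le` — the second-derivative test for the
  differenced sums `∑_{a<n≤b-r} e(f(n+r) - f(n))`.
* `Literature.NumberTheory.LFunctions.VdC.thirdDerivTest_yang` — **Yang's Lemma 2.4**.

## References

* A. Yang, *Explicit bounds on `ζ(s)` in the critical strip and a zero-free region*, J. Math.
  Anal. Appl. 534 (2024) 128124 = arXiv:2301.03165v3, Lemma 2.4 and its proof.
  [cite: Yang2024, Lemma 2.4]
* D. Patel, A. Yang, *An explicit sub-Weyl bound for `ζ(1/2 + it)`*, J. Number Theory 262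
  (2024), Lemma 1.4 (`k = 3`). [cite: PatelYang2024, Lemma 1.4]
-/

noncomputable section

open Finset Real

namespace Literature.NumberTheory.LFunctions
namespace VdC

/-! ### The constants -/

/-- `K(η, h) = 1/η + 32 η^{1/2} h/(15√π)`, the base of Yang's `λ₀ = K^{-3}`. [cite: Yang2024, Lemma 2.4] -/
def yangK (η h : ℝ) : ℝ := 1 / η + 32 * Real.sqrt η * h / (15 * Real.sqrt π)

/-- Yang's `λ₀ := (1/η₃ + 32 η₃^{1/2} h/(15√π))^{-3}`. [cite: Yang2024, Lemma 2.4] -/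
def yangLambda0 (η h : ℝ) : ℝ := yangK η h ^ (-3 : ℝ)

/-- Yang's `κ := (1/2)√(1 + (3/8) π^{1/2} η₃^{3/2}) - 1/2` (proof of Lemma 2.4), so that
`δ₃ = √(1 + κ)` and `32κ(1+κ)/(3π^{1/2}η₃^{3/2}) = 1`. [cite: Yang2024, Lemma 2.4 (proof)] -/
def yangKappa (η : ℝ) : ℝ := 1 / 2 * Real.sqrt (1 + 3 / 8 * Real.sqrt π * η ^ (3 / 2 : ℝ)) - 1 / 2

/-- Yang's `δ₃ := √(1/2 + (1/2)√(1 + (3/8) π^{1/2} η₃^{3/2}))`. [cite: Yang2024, Lemma 2.4] -/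
def yangDelta3 (η : ℝ) : ℝ :=
  Real.sqrt (1 / 2 + 1 / 2 * Real.sqrt (1 + 3 / 8 * Real.sqrt π * η ^ (3 / 2 : ℝ)))

/-- Yang's `A₃(η₃, h) := √(1/(η₃h) + (32/(15√π)) √(η₃ + λ₀^{1/3}) + (1/3)(η₃ + λ₀^{1/3}) λ₀^{1/3}) · δ₃`.
[cite: Yang2024, Lemma 2.4] -/
def yangA3 (η h : ℝ) : ℝ :=
  Real.sqrt (1 / (η * h) + 32 / (15 * Real.sqrt π) * Real.sqrt (η + yangLambda0 η h ^ (1 / 3 : ℝ))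
    + 1 / 3 * (η + yangLambda0 η h ^ (1 / 3 : ℝ)) * yangLambda0 η h ^ (1 / 3 : ℝ)) * yangDelta3 η

/-- Yang's `B₃(η₃) := (√32/(√3 π^{1/4} η₃^{1/4})) δ₃`. [cite: Yang2024, Lemma 2.4] -/
def yangB3 (η : ℝ) : ℝ := Real.sqrt 32 / (Real.sqrt 3 * π ^ (1 / 4 : ℝ) * η ^ (1 / 4 : ℝ)) * yangDelta3 η

section constants

variable {η h : ℝ}

/-- `K > 0`. [folklore] -/
theorem yangK_pos (hη : 0 < η) (hh : 0 ≤ h) : 0 < yangK η h := by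
  unfold yangK; positivity

/-- `λ₀^{1/3} = K⁻¹`. [folklore] -/
theorem yangLambda0_rpow_third (hη : 0 < η) (hh : 0 ≤ h) :
    yangLambda0 η h ^ (1 / 3 : ℝ) = (yangK η h)⁻¹ := by
  unfold yangLambda0
  rw [← Real.rpow_mul (yangK_pos hη hh).le]
  norm_num
  exact Real.rpow_neg_one (yangK η h)

/-- `η^{3/2} = η √η`. [folklore] -/
theorem rpow_three_halves (hη : 0 ≤ η) : η ^ (3 / 2 : ℝ) = η * Real.sqrt η := by
  rw [show (3 / 2 : ℝ) = 1 + 1 / 2 by norm_num, Real.rpow_add' hη (by norm_num), Real.rpow_one,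
    Real.sqrt_eq_rpow]

/-- `κ > 0`. [folklore] -/
theorem yangKappa_pos (hη : 0 < η) : 0 < yangKappa η := by
  unfold yangKappa
  have h1 : 1 < 1 + 3 / 8 * Real.sqrt π * η ^ (3 / 2 : ℝ) := by
    have : 0 < 3 / 8 * Real.sqrt π * η ^ (3 / 2 : ℝ) := by positivity
    linarith
  have h2 : 1 < Real.sqrt (1 + 3 / 8 * Real.sqrt π * η ^ (3 / 2 : ℝ)) := by
    rw [show (1:ℝ) = Real.sqrt 1 from Real.sqrt_one.symm]
    exact Real.sqrt_lt_sqrt (by norm_num) (by rwa [Real.sqrt_one])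
  linarith

/-- `κ(1 + κ) = (3/32) √π η^{3/2}` (i.e. `32κ(1+κ)/(3π^{1/2}η^{3/2}) = 1`).
[cite: Yang2024, Lemma 2.4 (proof)] -/
theorem yangKappa_mul (hη : 0 < η) :
    yangKappa η * (1 + yangKappa η) = 3 / 32 * Real.sqrt π * η ^ (3 / 2 : ℝ) := by
  unfold yangKappa
  set c : ℝ := 3 / 8 * Real.sqrt π * η ^ (3 / 2 : ℝ) with hc
  have hc0 : 0 ≤ c := by positivity
  have hs : Real.sqrt (1 + c) ^ 2 = 1 + c := Real.sq_sqrt (by linarith)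
  nlinarith [hs]

/-- `δ₃² = 1 + κ`. [cite: Yang2024, Lemma 2.4 (proof)] -/
theorem yangDelta3_sq (hη : 0 < η) : yangDelta3 η ^ 2 = 1 + yangKappa η := by
  unfold yangDelta3 yangKappa
  rw [Real.sq_sqrt (by positivity)]
  ring

/-- `δ₃ > 0`. [folklore] -/
theorem yangDelta3_pos (hη : 0 < η) : 0 < yangDelta3 η := by
  unfold yangDelta3; positivity

/-- `δ₃ ≥ 1`. [folklore] -/
theorem one_le_yangDelta3 (hη : 0 < η) : 1 ≤ yangDelta3 η := by
  have h1 := yangDelta3_sq hη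
  have h2 := yangKappa_pos hη
  have h3 := yangDelta3_pos hη
  nlinarith

/-- `B₃² = 32/(3 √π √η) · δ₃²`. [folklore] -/
theorem yangB3_sq (hη : 0 < η) :
    yangB3 η ^ 2 = 32 / (3 * Real.sqrt π * Real.sqrt η) * yangDelta3 η ^ 2 := by
  unfold yangB3
  have hπ := Real.pi_pos
  have h4π : (π ^ (1 / 4 : ℝ)) ^ 2 = Real.sqrt π := by
    rw [← Real.rpow_natCast, ← Real.rpow_mul hπ.le, Real.sqrt_eq_rpow]; norm_num
  have h4η : (η ^ (1 / 4 : ℝ)) ^ 2 = Real.sqrt η := by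
    rw [← Real.rpow_natCast, ← Real.rpow_mul hη.le, Real.sqrt_eq_rpow]; norm_num
  have h32 : Real.sqrt 32 ^ 2 = 32 := Real.sq_sqrt (by norm_num)
  have h3 : Real.sqrt 3 ^ 2 = 3 := Real.sq_sqrt (by norm_num)
  rw [mul_pow, div_pow, mul_pow, mul_pow, h4π, h4η, h32, h3]

/-- `B₃² = η/κ`, the identity behind the range `λ₃ ≤ λ₁`. [cite: Yang2024, Lemma 2.4 (proof)] -/
theorem yangB3_sq_eq (hη : 0 < η) : yangB3 η ^ 2 = η / yangKappa η := by
  rw [yangB3_sq hη, yangDelta3_sq hη]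
  have hk := yangKappa_mul hη
  have hkpos := yangKappa_pos hη
  rw [rpow_three_halves hη.le] at hk
  have hsη : 0 < Real.sqrt η := Real.sqrt_pos.2 hη
  have hsπ : 0 < Real.sqrt π := Real.sqrt_pos.2 Real.pi_pos
  field_simp
  nlinarith [hk, hsη, hsπ]

/-- `B₃ > 0`. [folklore] -/
theorem yangB3_pos (hη : 0 < η) : 0 < yangB3 η := by
  unfold yangB3
  have := yangDelta3_pos hη
  positivity

/-- The lower bound `A₃ ≥ √(1/(ηh) + (32/(15√π)) √η) · δ₃` behind the range `λ₃ ≥ λ₀`.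
[cite: Yang2024, Lemma 2.4 (proof)] -/
theorem yangA3_div_ge (hη : 0 < η) (hh : 1 ≤ h) :
    Real.sqrt (1 / (η * h) + 32 / (15 * Real.sqrt π) * Real.sqrt η) * yangDelta3 η ≤ yangA3 η h := by
  unfold yangA3
  have hh0 : 0 ≤ h := by linarith
  rw [yangLambda0_rpow_third hη hh0]
  have hK := yangK_pos hη hh0
  have hu0 : 0 < (yangK η h)⁻¹ := inv_pos.2 hK
  refine mul_le_mul_of_nonneg_right (Real.sqrt_le_sqrt ?_) (yangDelta3_pos hη).le
  have h1 : Real.sqrt η ≤ Real.sqrt (η + (yangK η h)⁻¹) := Real.sqrt_le_sqrt (by linarith)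
  have h2 : 0 ≤ 1 / 3 * (η + (yangK η h)⁻¹) * (yangK η h)⁻¹ := by positivity
  have h3 : 0 ≤ 32 / (15 * Real.sqrt π) := by positivity
  nlinarith [mul_le_mul_of_nonneg_left h1 h3]

/-- `A₃ > 0`. [folklore] -/
theorem yangA3_pos (hη : 0 < η) (hh : 1 ≤ h) : 0 < yangA3 η h := by
  refine lt_of_lt_of_le ?_ (yangA3_div_ge hη hh)
  have := yangDelta3_pos hη
  have : 0 < 1 / (η * h) + 32 / (15 * Real.sqrt π) * Real.sqrt η := by
    have : 0 < h := by linarith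
    positivity
  positivity

/-- The bracket `1/(ηh) + (32/(15√π))√(η + u) + (1/3)(η + u)u` is monotone in `u ≥ 0`, and at
`u = λ₀^{1/3} = K⁻¹` its square root times `δ₃` is `A₃`: for `0 ≤ u ≤ K⁻¹`,
`(1/(ηh) + (32/(15√π))√(η+u) + (1/3)(η+u)u) δ₃² ≤ A₃²`. [cite: Yang2024, Lemma 2.4 (proof)] -/
theorem bracket_le_yangA3_sq (hη : 0 < η) (hh : 1 ≤ h) {u : ℝ} (hu0 : 0 ≤ u)
    (hu : u ≤ (yangK η h)⁻¹) :
    (1 / (η * h) + 32 / (15 * Real.sqrt π) * Real.sqrt (η + u) + 1 / 3 * (η + u) * u)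
      * yangDelta3 η ^ 2 ≤ yangA3 η h ^ 2 := by
  unfold yangA3
  have hh0 : 0 ≤ h := by linarith
  have hKp := yangK_pos hη hh0
  have hhp : 0 < h := by linarith
  have hKi : 0 < (yangK η h)⁻¹ := inv_pos.2 hKp
  rw [yangLambda0_rpow_third hη hh0, mul_pow, Real.sq_sqrt (by positivity)]
  refine mul_le_mul_of_nonneg_right ?_ (sq_nonneg _)
  have h1 : Real.sqrt (η + u) ≤ Real.sqrt (η + (yangK η h)⁻¹) := Real.sqrt_le_sqrt (by linarith)
  have h2 : (η + u) * u ≤ (η + (yangK η h)⁻¹) * (yangK η h)⁻¹ :=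
    mul_le_mul (by linarith) hu hu0 (by linarith)
  have h3 : 0 ≤ 32 / (15 * Real.sqrt π) := by positivity
  nlinarith [mul_le_mul_of_nonneg_left h1 h3]

end constants

/-! ### The differenced sums -/

/-- **Second-derivative test for the differenced sums.** If `f, f', f''` are differentiable on
`[a, b]` (`a ≤ b` integers, `N = b - a`) with `λ ≤ f''' ≤ hλ` (`λ > 0`, `h ≥ 1`), then for every
integer `r ≥ 1`, since `g_r = f(· + r) - f` has `rλ ≤ g_r'' ≤ hrλ` on `[a, b - r]` (mean value
theorem), `‖∑_{a<n≤b-r} e(f(n+r) - f(n))‖ ≤ (4/√π) N h √r √λ + N h r λ + (4/√π)/(√r √λ)`.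
[cite: Yang2024, Lemma 2.4 (proof, eq. for `S_{g_r}(a, b - r)`)] -/
theorem norm_diffSum_le {f f' f'' f''' : ℝ → ℝ} {a b : ℤ} {lam h : ℝ} (hab : a ≤ b)
    (hlam : 0 < lam) (hh : 1 ≤ h)
    (hf : ∀ y ∈ Set.Icc (a : ℝ) b, HasDerivAt f (f' y) y)
    (hf' : ∀ y ∈ Set.Icc (a : ℝ) b, HasDerivAt f' (f'' y) y)
    (hf'' : ∀ y ∈ Set.Icc (a : ℝ) b, HasDerivAt f'' (f''' y) y)
    (hbound : ∀ y ∈ Set.Icc (a : ℝ) b, lam ≤ f''' y ∧ f''' y ≤ h * lam) {r : ℕ} (hr : 1 ≤ r) :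
    ‖∑ n ∈ Finset.Ioc a (b - r), e (f ((n + r : ℤ)) - f n)‖
      ≤ 4 / Real.sqrt π * ((b : ℝ) - a) * h * (Real.sqrt r * Real.sqrt lam)
        + ((b : ℝ) - a) * h * (r * lam) + 4 / Real.sqrt π * (1 / (Real.sqrt r * Real.sqrt lam)) := by
  have hπ := Real.pi_pos
  have hrpos : (0 : ℝ) < r := by exact_mod_cast hr
  have hab' : (a : ℝ) ≤ b := by exact_mod_cast hab
  have hh0 : 0 ≤ h := by linarith
  rcases lt_or_ge (b - r) a with hlt | hge
  · -- empty sum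
    rw [Finset.Ioc_eq_empty (by omega), sum_empty, norm_zero]
    positivity
  -- `g = f(· + r) - f` on `[a, b - r]`
  set b' : ℤ := b - r with hb'
  have hb'r : ((b' : ℤ) : ℝ) + r = b := by rw [hb']; push_cast; ring
  have hmem : ∀ y ∈ Set.Icc (a : ℝ) b', y ∈ Set.Icc (a : ℝ) b ∧ y + r ∈ Set.Icc (a : ℝ) b := by
    intro y hy
    have h2 : ((b' : ℤ) : ℝ) ≤ b := by linarith
    exact ⟨⟨hy.1, hy.2.trans h2⟩, ⟨by linarith [hy.1], by linarith [hy.2]⟩⟩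
  set g : ℝ → ℝ := fun y => f (y + r) - f y with hg
  set g' : ℝ → ℝ := fun y => f' (y + r) - f' y with hg'
  set g'' : ℝ → ℝ := fun y => f'' (y + r) - f'' y with hg''
  have hgd : ∀ y ∈ Set.Icc (a : ℝ) b', HasDerivAt g (g' y) y := fun y hy =>
    ((hf (y + r) (hmem y hy).2).comp_add_const y r).sub (hf y (hmem y hy).1)
  have hg'd : ∀ y ∈ Set.Icc (a : ℝ) b', HasDerivAt g' (g'' y) y := fun y hy =>
    ((hf' (y + r) (hmem y hy).2).comp_add_const y r).sub (hf' y (hmem y hy).1)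
  -- `rλ ≤ g'' ≤ hrλ` by the mean value theorem for `f''` on `[y, y + r]`
  have hg''b : ∀ y ∈ Set.Icc (a : ℝ) b', r * lam ≤ g'' y ∧ g'' y ≤ h * (r * lam) := by
    intro y hy
    have hsub : Set.Icc y (y + r) ⊆ Set.Icc (a : ℝ) b :=
      Set.Icc_subset_Icc (hmem y hy).1.1 (hmem y hy).2.2
    obtain ⟨ξ, hξ, hξ'⟩ := exists_hasDerivAt_eq_slope f'' f''' (by linarith : y < y + r)
      (fun x hx => (hf'' x (hsub hx)).continuousAt.continuousWithinAt)
      (fun x hx => hf'' x (hsub (Set.Ioo_subset_Icc_self hx)))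
    have hξI : ξ ∈ Set.Icc (a : ℝ) b := hsub (Set.Ioo_subset_Icc_self hξ)
    have heq : g'' y = f''' ξ * r := by
      simp only [hg'']
      have e1 : y + (r : ℝ) - y = r := by ring
      rw [hξ', e1]; field_simp
    obtain ⟨hl, hu⟩ := hbound ξ hξI
    rw [heq]
    constructor <;> nlinarith
  have h2 := secondDerivTest_yang (f := g) (f' := g') (f'' := g'') hge (by positivity) hh hgd hg'd
    (Or.inl hg''b)
  -- identify the sum
  have hsum : ∑ n ∈ Finset.Ioc a (b - r), e (f ((n + r : ℤ)) - f n) = ∑ n ∈ Finset.Ioc a b', e (g n) := by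
    refine Finset.sum_congr rfl fun n _ => ?_
    simp only [hg]
    push_cast
    ring_nf
  rw [hsum]
  refine h2.trans ?_
  have hN : ((b' : ℤ) : ℝ) - a ≤ (b : ℝ) - a := by linarith
  have hN0 : 0 ≤ ((b' : ℤ) : ℝ) - a := by
    have : ((a : ℤ) : ℝ) ≤ b' := by exact_mod_cast hge
    linarith
  have hsq : Real.sqrt (r * lam) = Real.sqrt r * Real.sqrt lam := Real.sqrt_mul hrpos.le lam
  rw [hsq]
  have hs0 : 0 ≤ Real.sqrt r * Real.sqrt lam := by positivity
  gcongr

/-! ### Yang's Lemma 2.4 -/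

set_option maxHeartbeats 400000 in
/-- **Yang's explicit third-derivative test, the case `f''' > 0`.** [cite: Yang2024, Lemma 2.4] -/
theorem thirdDerivTest_yang_pos {f f' f'' f''' : ℝ → ℝ} {a b : ℤ} {lam h η : ℝ} (hab : a ≤ b)
    (hlam : 0 < lam) (hh : 1 ≤ h) (hη : 0 < η)
    (hf : ∀ y ∈ Set.Icc (a : ℝ) b, HasDerivAt f (f' y) y)
    (hf' : ∀ y ∈ Set.Icc (a : ℝ) b, HasDerivAt f' (f'' y) y)
    (hf'' : ∀ y ∈ Set.Icc (a : ℝ) b, HasDerivAt f'' (f''' y) y)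
    (hbound : ∀ y ∈ Set.Icc (a : ℝ) b, lam ≤ f''' y ∧ f''' y ≤ h * lam) :
    ‖∑ n ∈ Finset.Ioc a b, e (f n)‖
      ≤ yangA3 η h * Real.sqrt h * ((b : ℝ) - a) * lam ^ (1 / 6 : ℝ)
        + yangB3 η * Real.sqrt ((b : ℝ) - a) * lam ^ (-(1 / 6 : ℝ)) := by
  have hπ := Real.pi_pos
  have hsπ : 0 < Real.sqrt π := Real.sqrt_pos.2 hπ
  have hh0 : 0 < h := by linarith
  have hA3 := yangA3_pos hη hh
  have hB3 := yangB3_pos hη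
  have hδ := yangDelta3_pos hη
  have hκ := yangKappa_pos hη
  set N : ℝ := (b : ℝ) - a with hN
  have hab' : (a : ℝ) ≤ b := by exact_mod_cast hab
  have hN0 : 0 ≤ N := by rw [hN]; linarith
  -- `u = λ^{1/3}`: `u³ = λ`, `√u = λ^{1/6}`, `1/√u = λ^{-1/6}`
  set u : ℝ := lam ^ (1 / 3 : ℝ) with hu
  have hu0 : 0 < u := Real.rpow_pos_of_pos hlam _
  have hu3 : u ^ 3 = lam := by
    rw [hu, ← Real.rpow_natCast, ← Real.rpow_mul hlam.le]; norm_num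
  have hsu : Real.sqrt u = lam ^ (1 / 6 : ℝ) := by
    rw [hu, Real.sqrt_eq_rpow, ← Real.rpow_mul hlam.le]; norm_num
  have hsu' : 1 / Real.sqrt u = lam ^ (-(1 / 6 : ℝ)) := by
    rw [hsu, Real.rpow_neg hlam.le, one_div]
  have hsl : Real.sqrt lam = u * Real.sqrt u := by
    have : lam = (u * Real.sqrt u) ^ 2 := by
      rw [mul_pow, Real.sq_sqrt hu0.le, ← hu3]; ring
    rw [this, Real.sqrt_sq (by positivity)]
  have hsqu : Real.sqrt u ^ 2 = u := Real.sq_sqrt hu0.le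
  have hsqu0 : 0 < Real.sqrt u := Real.sqrt_pos.2 hu0
  rw [← hsu, ← hsu']
  -- the trivial bound
  have htriv : ‖∑ n ∈ Finset.Ioc a b, e (f n)‖ ≤ N := by
    refine (norm_sum_e_le_card _ (fun n => f n)).trans ?_
    rw [Int.card_Ioc, hN]
    have h1 : (((b - a).toNat : ℕ) : ℤ) = b - a := Int.toNat_of_nonneg (by linarith)
    have h2 : (((b - a).toNat : ℕ) : ℝ) = ((b - a : ℤ) : ℝ) := by exact_mod_cast h1
    rw [h2]; push_cast; exact le_rfl
  have hRHS0 : 0 ≤ yangB3 η * Real.sqrt N * (1 / Real.sqrt u) := by positivity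
  have hRHS1 : 0 ≤ yangA3 η h * Real.sqrt h * N * Real.sqrt u := by positivity
  -- constants `K`, `u₀ = K⁻¹`
  have hK := yangK_pos hη hh0.le
  set K := yangK η h with hKdef
  -- Case A: `u ≥ K⁻¹` (`λ ≥ λ₀`): trivial bound
  rcases le_or_gt K⁻¹ u with hA | hA
  · have key : 1 ≤ yangA3 η h * Real.sqrt h * Real.sqrt u := by
      -- `A₃ √h √u ≥ √(M) δ₃ √h √(K⁻¹) ≥ √(M h K⁻¹) = 1`, `M h = K`
      set M : ℝ := 1 / (η * h) + 32 / (15 * Real.sqrt π) * Real.sqrt η with hM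
      have hM0 : 0 < M := by positivity
      have hMh : M * h = K := by rw [hM, hKdef, yangK]; field_simp
      have h1 : Real.sqrt M * yangDelta3 η ≤ yangA3 η h := yangA3_div_ge hη hh
      have h2 : Real.sqrt M ≤ yangA3 η h := by
        have := one_le_yangDelta3 hη
        have h3 : Real.sqrt M * 1 ≤ Real.sqrt M * yangDelta3 η :=
          mul_le_mul_of_nonneg_left this (Real.sqrt_nonneg _)
        linarith
      have h4 : Real.sqrt (K⁻¹) ≤ Real.sqrt u := Real.sqrt_le_sqrt hA
      have h5 : Real.sqrt M * Real.sqrt h * Real.sqrt (K⁻¹) = 1 := by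
        rw [← Real.sqrt_mul hM0.le, ← Real.sqrt_mul (by positivity), hMh,
          mul_inv_cancel₀ hK.ne', Real.sqrt_one]
      calc (1 : ℝ) = Real.sqrt M * Real.sqrt h * Real.sqrt (K⁻¹) := h5.symm
        _ ≤ yangA3 η h * Real.sqrt h * Real.sqrt u := by
            apply mul_le_mul (mul_le_mul_of_nonneg_right h2 (Real.sqrt_nonneg _)) h4
              (Real.sqrt_nonneg _) (by positivity)
    calc ‖∑ n ∈ Finset.Ioc a b, e (f n)‖ ≤ N := htriv
      _ = N * 1 := (mul_one N).symm
      _ ≤ N * (yangA3 η h * Real.sqrt h * Real.sqrt u) := mul_le_mul_of_nonneg_left key hN0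
      _ = yangA3 η h * Real.sqrt h * N * Real.sqrt u := by ring
      _ ≤ _ := le_add_of_nonneg_right hRHS0
  -- Case B: `u ≤ η/(κN)` (`λ ≤ λ₁`), including `N = 0`: trivial bound
  by_cases hB : u * (yangKappa η * N) ≤ η
  · have key : N ≤ yangB3 η * Real.sqrt N * (1 / Real.sqrt u) := by
      -- `N √u ≤ B₃ √N` iff `N u ≤ B₃² = η/κ`... via squares
      rw [mul_one_div, le_div_iff₀ hsqu0]
      have h1 : (N * Real.sqrt u) ^ 2 ≤ (yangB3 η * Real.sqrt N) ^ 2 := by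
        rw [mul_pow, mul_pow, hsqu, Real.sq_sqrt hN0, yangB3_sq_eq hη, div_mul_eq_mul_div,
          le_div_iff₀ hκ]
        nlinarith [hB, hN0, hu0.le]
      have h2 : 0 ≤ yangB3 η * Real.sqrt N := by positivity
      exact (pow_le_pow_iff_left₀ (by positivity) h2 two_ne_zero).1 h1
    calc ‖∑ n ∈ Finset.Ioc a b, e (f n)‖ ≤ N := htriv
      _ ≤ yangB3 η * Real.sqrt N * (1 / Real.sqrt u) := key
      _ ≤ _ := le_add_of_nonneg_left hRHS1
  -- Main case: `η/(κN) < u < K⁻¹`; in particular `N > 0`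
  have hB' : η < u * (yangKappa η * N) := not_le.1 hB
  clear hB
  have hB := hB'
  have hNpos : 0 < N := by
    by_contra hc
    have : N = 0 := le_antisymm (not_lt.1 hc) hN0
    rw [this, mul_zero, mul_zero] at hB
    linarith
  -- `q = ⌈η/u⌉`
  set q : ℕ := ⌈η / u⌉₊ with hq
  have hηu : 0 < η / u := by positivity
  have hq1 : 1 ≤ q := Nat.one_le_iff_ne_zero.2 (Nat.pos_iff_ne_zero.1 (Nat.ceil_pos.2 hηu))
  have hqlo : η / u ≤ q := Nat.le_ceil _
  have hqhi : (q : ℝ) < η / u + 1 := Nat.ceil_lt_add_one hηu.le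
  have hqpos : (0 : ℝ) < q := by exact_mod_cast hq1
  -- the A-process
  have hAP := aProcess_yang f hab hq1
  -- the weighted sum of differenced sums
  have hW : ∑ r ∈ Finset.Ico 1 q, (1 - (r : ℝ) / q) *
        ‖∑ n ∈ Finset.Ioc a (b - r), e (f ((n + r : ℤ)) - f n)‖
      ≤ 4 / Real.sqrt π * N * h * Real.sqrt lam * (4 / 15 * q * Real.sqrt q)
        + N * h * lam * ((q : ℝ) ^ 2 / 6)
        + 4 / Real.sqrt π * (1 / Real.sqrt lam) * (4 / 3 * Real.sqrt q) := by
    have hterm : ∀ r ∈ Finset.Ico 1 q, (1 - (r : ℝ) / q) *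
        ‖∑ n ∈ Finset.Ioc a (b - r), e (f ((n + r : ℤ)) - f n)‖
        ≤ 4 / Real.sqrt π * N * h * Real.sqrt lam * ((1 - (r : ℝ) / q) * Real.sqrt r)
          + N * h * lam * ((1 - (r : ℝ) / q) * r)
          + 4 / Real.sqrt π * (1 / Real.sqrt lam) * ((1 - (r : ℝ) / q) / Real.sqrt r) := by
      intro r hr
      rw [Finset.mem_Ico] at hr
      have hw : 0 ≤ 1 - (r : ℝ) / q := by
        rw [sub_nonneg, div_le_one hqpos]; exact_mod_cast hr.2.le
      have hb := norm_diffSum_le hab hlam hh hf hf' hf'' hbound hr.1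
      have hrpos : (0 : ℝ) < r := by exact_mod_cast hr.1
      have hsr : 0 < Real.sqrt r := Real.sqrt_pos.2 hrpos
      have hsl0 : 0 < Real.sqrt lam := Real.sqrt_pos.2 hlam
      calc (1 - (r : ℝ) / q) * ‖∑ n ∈ Finset.Ioc a (b - r), e (f ((n + r : ℤ)) - f n)‖
          ≤ (1 - (r : ℝ) / q) * (4 / Real.sqrt π * ((b : ℝ) - a) * h * (Real.sqrt r * Real.sqrt lam)
            + ((b : ℝ) - a) * h * (r * lam) + 4 / Real.sqrt π * (1 / (Real.sqrt r * Real.sqrt lam))) :=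
            mul_le_mul_of_nonneg_left hb hw
        _ = _ := by rw [← hN]; ring
    refine (Finset.sum_le_sum hterm).trans ?_
    rw [Finset.sum_add_distrib, Finset.sum_add_distrib, ← Finset.mul_sum, ← Finset.mul_sum,
      ← Finset.mul_sum]
    have d1 := dhir_half q hq1
    have d2 := dhir_one q hq1
    have d3 := dhir_neg_half q hq1
    gcongr
  -- combine: `S² ≤ (N - 1 + q)(N/q + (2/q) W)`
  set S := ‖∑ n ∈ Finset.Ioc a b, e (f n)‖ with hS
  have hS0 : 0 ≤ S := norm_nonneg _
  have hsq0 : 0 < Real.sqrt q := Real.sqrt_pos.2 hqpos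
  have hsqq : Real.sqrt q ^ 2 = q := Real.sq_sqrt hqpos.le
  have hsl0 : 0 < Real.sqrt lam := Real.sqrt_pos.2 hlam
  -- bounds in terms of `u`: `q ≤ (η+u)/u`, `N/q ≤ Nu/η`, `√λ√q ≤ u√(η+u)`, `λq ≤ u²(η+u)`,
  -- `1/(√λ√q) ≤ 1/(u√η)`, `N - 1 + q ≤ N + η/u`
  have hq_le : (q : ℝ) ≤ (η + u) / u := by
    have : (η + u) / u = η / u + 1 := by field_simp
    rw [this]; exact hqhi.le
  have huq : u * q ≤ η + u := by
    calc u * q ≤ u * ((η + u) / u) := mul_le_mul_of_nonneg_left hq_le hu0.le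
      _ = η + u := by field_simp
  have huq' : η ≤ u * q := by
    rw [div_le_iff₀ hu0] at hqlo; linarith
  have hNq : N / q ≤ N * u / η :=
    (div_le_div_of_nonneg_left hN0 hηu hqlo).trans_eq (by field_simp)
  have hX : Real.sqrt lam * Real.sqrt q ≤ u * Real.sqrt (η + u) := by
    rw [hsl, mul_assoc, ← Real.sqrt_mul hu0.le]
    exact mul_le_mul_of_nonneg_left (Real.sqrt_le_sqrt huq) hu0.le
  have hY : lam * q ≤ u ^ 2 * (η + u) := by
    rw [← hu3]
    calc u ^ 3 * q = u ^ 2 * (u * q) := by ring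
      _ ≤ u ^ 2 * (η + u) := mul_le_mul_of_nonneg_left huq (by positivity)
  have hsη : 0 < Real.sqrt η := Real.sqrt_pos.2 hη
  have hZ : 1 / (Real.sqrt lam * Real.sqrt q) ≤ 1 / (u * Real.sqrt η) := by
    apply one_div_le_one_div_of_le (by positivity)
    rw [hsl, mul_assoc, ← Real.sqrt_mul hu0.le]
    exact mul_le_mul_of_nonneg_left (Real.sqrt_le_sqrt huq') hu0.le
  have hF1 : N - 1 + q ≤ N + η / u := by linarith
  have hF1' : 0 ≤ N - 1 + q := by
    have : (1 : ℝ) ≤ q := by exact_mod_cast hq1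
    linarith
  -- the second factor
  set c₁ : ℝ := 32 / (15 * Real.sqrt π) with hc₁
  set c₂ : ℝ := 32 / (3 * Real.sqrt π) with hc₂
  set W := ∑ r ∈ Finset.Ico 1 q, (1 - (r : ℝ) / q) *
        ‖∑ n ∈ Finset.Ioc a (b - r), e (f ((n + r : ℤ)) - f n)‖ with hWdef
  have hW2 : 2 / q * W ≤ c₁ * N * h * (Real.sqrt lam * Real.sqrt q) + 1 / 3 * N * h * (lam * q)
      + c₂ * (1 / (Real.sqrt lam * Real.sqrt q)) := by
    have h1 : 2 / q * W ≤ 2 / q * (4 / Real.sqrt π * N * h * Real.sqrt lam * (4 / 15 * q * Real.sqrt q)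
        + N * h * lam * ((q : ℝ) ^ 2 / 6)
        + 4 / Real.sqrt π * (1 / Real.sqrt lam) * (4 / 3 * Real.sqrt q)) :=
      mul_le_mul_of_nonneg_left hW (by positivity)
    refine h1.trans (le_of_eq ?_)
    rw [hc₁, hc₂]
    set s : ℝ := Real.sqrt q with hs
    rw [show (q : ℝ) = s ^ 2 from hsqq.symm]
    have hs0 : s ≠ 0 := hsq0.ne'
    field_simp
    ring
  set Q : ℝ := N * u / η + c₁ * N * h * (u * Real.sqrt (η + u)) + 1 / 3 * N * h * (u ^ 2 * (η + u))
      + c₂ * (1 / (u * Real.sqrt η)) with hQ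
  have hF2 : N / q + 2 / q * W ≤ Q := by
    rw [hQ]
    have hc₁0 : 0 ≤ c₁ * N * h := by positivity
    have hc₂0 : 0 ≤ c₂ := by positivity
    have h13 : 0 ≤ 1 / 3 * N * h := by positivity
    have t1 := mul_le_mul_of_nonneg_left hX hc₁0
    have t2 := mul_le_mul_of_nonneg_left hY h13
    have t3 := mul_le_mul_of_nonneg_left hZ hc₂0
    linarith [hW2, hNq]
  have hF2' : 0 ≤ N / q + 2 / q * W := by
    have : 0 ≤ W := Finset.sum_nonneg fun r hr => by
      rw [Finset.mem_Ico] at hr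
      have hw : 0 ≤ 1 - (r : ℝ) / q := by
        rw [sub_nonneg, div_le_one hqpos]; exact_mod_cast hr.2.le
      exact mul_nonneg hw (norm_nonneg _)
    positivity
  -- `S² ≤ (N + η/u) Q`
  have hS2 : S ^ 2 ≤ (N + η / u) * Q := by
    have := hAP
    rw [← hN] at this
    exact this.trans (mul_le_mul hF1 hF2 hF2' (by positivity))
  -- `(N + η/u) Q = (1 + η/(uN)) (h N² u Br + (c₂/√η) N/u)` and the three comparisons
  set Br : ℝ := 1 / (η * h) + c₁ * Real.sqrt (η + u) + 1 / 3 * (η + u) * u with hBr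
  have hBr0 : 0 ≤ Br := by positivity
  have eQ : (N + η / u) * Q = (1 + η / (u * N)) * (h * N ^ 2 * u * Br + c₂ / Real.sqrt η * N / u) := by
    rw [hQ, hBr]
    field_simp
  have hf1 : 1 + η / (u * N) ≤ yangDelta3 η ^ 2 := by
    rw [yangDelta3_sq hη, add_le_add_iff_left, div_le_iff₀ (by positivity)]
    linarith
  have hf2 : 0 ≤ h * N ^ 2 * u * Br + c₂ / Real.sqrt η * N / u := by positivity
  have hBrA : Br * yangDelta3 η ^ 2 ≤ yangA3 η h ^ 2 := by
    have := bracket_le_yangA3_sq hη hh hu0.le hA.le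
    rw [hBr, hc₁]
    convert this using 2
  have hB3 : c₂ / Real.sqrt η * yangDelta3 η ^ 2 = yangB3 η ^ 2 := by
    rw [yangB3_sq hη, hc₂]
    field_simp
  have hS3 : S ^ 2 ≤ yangA3 η h ^ 2 * h * N ^ 2 * u + yangB3 η ^ 2 * N / u := by
    calc S ^ 2 ≤ (N + η / u) * Q := hS2
      _ = (1 + η / (u * N)) * (h * N ^ 2 * u * Br + c₂ / Real.sqrt η * N / u) := eQ
      _ ≤ yangDelta3 η ^ 2 * (h * N ^ 2 * u * Br + c₂ / Real.sqrt η * N / u) :=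
          mul_le_mul_of_nonneg_right hf1 hf2
      _ = h * N ^ 2 * u * (Br * yangDelta3 η ^ 2) + (c₂ / Real.sqrt η * yangDelta3 η ^ 2) * N / u := by
          ring
      _ ≤ h * N ^ 2 * u * yangA3 η h ^ 2 + yangB3 η ^ 2 * N / u := by
          rw [hB3]
          have : 0 ≤ h * N ^ 2 * u := by positivity
          have := mul_le_mul_of_nonneg_left hBrA this
          linarith
      _ = _ := by ring
  -- take square roots
  have hR : 0 ≤ yangA3 η h * Real.sqrt h * N * Real.sqrt u + yangB3 η * Real.sqrt N * (1 / Real.sqrt u) := by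
    positivity
  refine (pow_le_pow_iff_left₀ hS0 hR two_ne_zero).1 (hS3.trans ?_)
  have hsh : Real.sqrt h ^ 2 = h := Real.sq_sqrt hh0.le
  have hsN : Real.sqrt N ^ 2 = N := Real.sq_sqrt hN0
  have hcross : 0 ≤ 2 * (yangA3 η h * Real.sqrt h * N * Real.sqrt u)
      * (yangB3 η * Real.sqrt N * (1 / Real.sqrt u)) := by positivity
  have e1 : (yangA3 η h * Real.sqrt h * N * Real.sqrt u + yangB3 η * Real.sqrt N * (1 / Real.sqrt u)) ^ 2
      = yangA3 η h ^ 2 * Real.sqrt h ^ 2 * N ^ 2 * Real.sqrt u ^ 2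
        + yangB3 η ^ 2 * Real.sqrt N ^ 2 * (1 / Real.sqrt u) ^ 2
        + 2 * (yangA3 η h * Real.sqrt h * N * Real.sqrt u) * (yangB3 η * Real.sqrt N * (1 / Real.sqrt u)) := by
    ring
  have h1u : (1 / Real.sqrt u) ^ 2 = 1 / u := by rw [div_pow, one_pow, hsqu]
  rw [e1, hsh, hsN, hsqu, h1u]
  have e2 : yangB3 η ^ 2 * N * (1 / u) = yangB3 η ^ 2 * N / u := by ring
  rw [e2]
  linarith

/-- **Yang's explicit third-derivative test** (Yang 2024, Lemma 2.4): let `a ≤ b` be integers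
(`N = b - a`), `f, f', f''` differentiable on `[a, b]` with `λ ≤ f''' ≤ hλ` there, or
`λ ≤ -f''' ≤ hλ` there (`λ > 0`, `h ≥ 1`). Then for every `η > 0`,
`‖∑_{a<n≤b} e(f(n))‖ ≤ A₃(η, h) h^{1/2} N λ^{1/6} + B₃(η) N^{1/2} λ^{-1/6}` with Yang's constants
`Literature.NumberTheory.LFunctions.VdC.yangA3`, `Literature.NumberTheory.LFunctions.VdC.yangB3`.
[cite: Yang2024, Lemma 2.4] -/
theorem thirdDerivTest_yang {f f' f'' f''' : ℝ → ℝ} {a b : ℤ} {lam h η : ℝ} (hab : a ≤ b)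
    (hlam : 0 < lam) (hh : 1 ≤ h) (hη : 0 < η)
    (hf : ∀ y ∈ Set.Icc (a : ℝ) b, HasDerivAt f (f' y) y)
    (hf' : ∀ y ∈ Set.Icc (a : ℝ) b, HasDerivAt f' (f'' y) y)
    (hf'' : ∀ y ∈ Set.Icc (a : ℝ) b, HasDerivAt f'' (f''' y) y)
    (hbound : (∀ y ∈ Set.Icc (a : ℝ) b, lam ≤ f''' y ∧ f''' y ≤ h * lam) ∨
      (∀ y ∈ Set.Icc (a : ℝ) b, lam ≤ -f''' y ∧ -f''' y ≤ h * lam)) :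
    ‖∑ n ∈ Finset.Ioc a b, e (f n)‖
      ≤ yangA3 η h * Real.sqrt h * ((b : ℝ) - a) * lam ^ (1 / 6 : ℝ)
        + yangB3 η * Real.sqrt ((b : ℝ) - a) * lam ^ (-(1 / 6 : ℝ)) := by
  rcases hbound with hpos | hneg
  · exact thirdDerivTest_yang_pos hab hlam hh hη hf hf' hf'' hpos
  · rw [← norm_sum_e_neg]
    exact thirdDerivTest_yang_pos (f := fun y => -f y) (f' := fun y => -f' y)
      (f'' := fun y => -f'' y) (f''' := fun y => -f''' y) hab hlam hh hη
      (fun y hy => (hf y hy).neg) (fun y hy => (hf' y hy).neg) (fun y hy => (hf'' y hy).neg) hneg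

end VdC
end Literature.NumberTheory.LFunctions
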